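import Mathlib
import Literature.Analysis.FluidPDE.ReflectionPlaneStrainRiccati
import HarnessLib

/-!
# The plane-normal strain on the Z8 MIRROR PLANE is Chae–Constantin–Wu's `λ₃`: the forced Riccati law
# `D_t σ = −σ² − ∂_z²p` in meridional form, its threshold `−√(−∂_z²p)`, and what the Z8-1 endings read

HONEST FRAMING (cell ns-blowup GROUP B «PROFILE SEARCH», zone Z8 «Hou–Luo corner analogue WITHOUT the
wall», stage-1 question «does the wall-free family keep a collapsing point on the mirror plane at all»;
cases Z8-1L′…L⁵ of the wall-free axisymmetric EULER (D)-class MODEL runs, word of record (iii) UNDECIDED —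
RANGE-LIMITED with descriptive support «exponential at the saturated strain», RULING (id)(1); human rulings
D-0035/D-0074/D-0081): **real one-variable calculus (product rule at a point, ODE comparison by fencing)
kernel-checked; the reduced equations and the smoothness of the traces are HYPOTHESES; nothing here asserts
that any run obeys them and nothing is a statement about Euler or Navier–Stokes blow-up; «violates: none —
no object / dictionary + comparison lemmas».**

THE DICTIONARY (§1). On the mirror plane `{z = 0}` of an axisymmetric flow (reflection `z ↦ −z`: `u^z`
odd, `u^r, u^θ, p` even — both Z8 classes L/O and R/E) write `U = u^r|₀`, `σ = ∂_z u^z|₀` (plane-normal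
strain). The trace of `div u = 0` is `∂ᵣU + U/r + σ = 0` (`normalStrain_eq_of_divFree_trace`), so at a
stagnation ring (`U(r₀) = 0`) `σ = −∂ᵣU` and in general the e14ax FRONT STRAIN `s = −∂ᵣu^r(r_G)` of
`PlaneFrontSteepnessClock` is `σ(r_G) + U(r_G)/r_G` (`frontStrain_eq`). The plane is CCW's reflection plane
`{x₃ = 0}` (Chae–Constantin–Wu 2012 §4.1, typed in `Literature/…/ReflectionPlaneStrainRiccati`): with
meridional axes at the point (`x₁ ∥ e_r`, `x₂ ∥ e_θ`) the azimuthal derivative of the axisymmetric scalar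
`λ₃ = σ` vanishes, and CCW's (4.9) reads `σₜ + U σᵣ = −σ² − ∂_z²p|₀ (+ ∂_z f|₀)`
(`normalStrain_transport_meridional`, a specialisation of the Literature identity — swirl on the plane,
class R, does not enter). So ALONG PARTICLE PATHS ON THE PLANE the normal strain obeys the forced Riccati
law `σ̇ = −σ² + b(t)`, `b := −∂_z²p|₀` along the path: compression self-amplifies and ONE field, the normal
pressure curvature on the plane, decides.

THE THRESHOLD (§2, cell-own comparison lemmas, standard): `b ≤ B` and `σ(0) < −√B` ⇒ `σ ≤ σ(0)` and
breakdown before `log((σ₀ − √B)/(σ₀ + √B))/(2√B)` (`le_init_of_deriv_le_neg_sq_add`,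
`time_lt_of_deriv_le_neg_sq_add`; `B = 0` is CCW Thm 4.1, `Literature…time_lt_of_deriv_le_neg_sq`);
`b ≥ B₁ > 0` and `σ(0) > −√B₁` ⇒ `σ ≥ min(σ(0), √B₁)` for all later times (`min_le_of_deriv_ge_neg_sq_add`):
no runaway. `−√b` is the watershed.

THE READINGS (§3) for the Z8-1 endings of PREREG-Z8-1L3/L4/L5 §4 (by `PlaneFrontSteepnessClock` the
registered question «accelerating `G₀` clock?» is «does the front strain grow geometrically or saturate»):
ending (i) «exponential at the SATURATED strain `s∞`» along a plane path READS `∂_z²p|₀ → −s∞² < 0` there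
(`normalCurvature_tendsto_of_saturation`; stationary instant: `pressureHessian_eq_neg_sq_of_stationary`) —
the plane has become a strict local pressure MAXIMUM across itself, exactly cancelling the self-amplification;
a KEEP-shape (accelerating clock ⇒ `∫ s = ∞` in finite time) needs `−∂_z²p|₀` to stay BELOW `σ²` with a
margin (CCW's printed sufficient sign is `∂_z²p ≥ 0`). Hence the successor-programme diagnostic this file
licenses: print `∂_z²p` on the plane at `r_G` / `r₀` beside `τ_k`. The companion file
`MirrorPlaneSimilitudePressure` computes `∂_z²p|₀` EXACTLY in the z-linear similitude of the Z8-0 pen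
(free space: `≤ 0` at every radius — the swirl OPPOSES plane collapse; wall: the corner compresses from rest).
WHAT IS NOT PROVED HERE: that any engine run is smooth or satisfies the reduced equations; existence of
particle paths; anything about NS. PLACEMENT: cell-own calculus next to `HouLuoMirrorPlaneGerm` /
`PlaneFrontSteepnessClock` (profile-eng-14 g7, Z8 engine-B seat, 0 kit). bears on LADDER-NS N5 / zone Z8
(stage-1 mechanism reading) → N1 linear core.
-/

noncomputable section

open Set Filter Real
open scoped Topology

namespace Summit.NavierStokesRegularity.OSWSelfSimilar
namespace MirrorPlaneStrainRiccati

open Literature.Analysis.FluidPDE.ReflectionPlaneStrain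

/-! ### §1 The axisymmetric mirror-plane dictionary -/

/-- **Trace of `div u = 0` on the plane.** At a point of the plane with `r > 0`: if
`∂ᵣu^r + u^r/r + ∂_z u^z = 0` there (`Ur + U/r + σ = 0`), then the plane-normal strain is
`σ = −(Ur + U/r)`; in particular at a stagnation ring (`U = 0`) `σ = −Ur`. [new here — dictionary] -/
theorem normalStrain_eq_of_divFree_trace {U Ur σ r : ℝ} (hdiv : Ur + U / r + σ = 0) :
    σ = -(Ur + U / r) ∧ (U = 0 → σ = -Ur) := by
  refine ⟨by linarith, fun hU => ?_⟩
  rw [hU, zero_div] at hdiv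
  linarith

/-- **The e14ax front strain in CCW's variable.** With `Ur + U/r + σ = 0` at the front radius `r_G`, the
registered estimator `s := −∂ᵣu^r(r_G)` of `PlaneFrontSteepnessClock` equals `σ(r_G) + U(r_G)/r_G`: the
front strain is the plane-normal strain plus the hoop term. [new here — dictionary] -/
theorem frontStrain_eq {U Ur σ r s : ℝ} (hdiv : Ur + U / r + σ = 0) (hs : s = -Ur) :
    s = σ + U / r := by
  linarith

/-- **CCW (4.9) in meridional form on the mirror plane.** The Literature identity
`normalStrain_transport_at_plane` at a point of the plane with meridional axes (`x₁ ∥ e_r`, so `v1 = u^r`,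
`w1 = ∂ᵣu^z` along the normal line; `x₂ ∥ e_θ`): for an AXISYMMETRIC flow the azimuthal derivative of the
scalar `∂_z u^z|₀` vanishes, `w2z0 = ∂_θ-derivative = 0`, and the identity reads
`∂_z uₜ^z + u^r · ∂_z∂ᵣu^z = −(∂_z u^z)² − ∂_z²p + ∂_z f` at `z = 0`, i.e. `σₜ + U σᵣ = −σ² − ∂_z²p|₀ (+ ∂_z f|₀)`
after exchanging mixed partials — the swirl `u^θ|₀` (class R) multiplies a vanishing derivative and drops.
(Chae–Constantin–Wu 2012 §4.1 (4.9) via `ReflectionPlaneStrain.normalStrain_transport_at_plane`, specialised) [new here — dictionary] -/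
theorem normalStrain_transport_meridional (w dw wt w1 w2 v1 v2 pz f : ℝ → ℝ)
    (ddw0 wtz0 w1z0 v1z0 v2z0 pzz0 fz0 : ℝ)
    (hE : ∀ z, wt z + v1 z * w1 z + v2 z * w2 z + w z * dw z = -(pz z) + f z)
    (hw0 : w 0 = 0) (hw10 : w1 0 = 0) (hw20 : w2 0 = 0)
    (hw : HasDerivAt w (dw 0) 0) (hdw : HasDerivAt dw ddw0 0) (hwt : HasDerivAt wt wtz0 0)
    (hw1 : HasDerivAt w1 w1z0 0) (haxi : HasDerivAt w2 0 0)
    (hv1 : HasDerivAt v1 v1z0 0) (hv2 : HasDerivAt v2 v2z0 0)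
    (hpz : HasDerivAt pz pzz0 0) (hf : HasDerivAt f fz0 0) :
    wtz0 + v1 0 * w1z0 = -(dw 0) ^ 2 - pzz0 + fz0 := by
  have h := normalStrain_transport_at_plane w dw wt w1 w2 v1 v2 pz f ddw0 wtz0 w1z0 0 v1z0 v2z0
    pzz0 fz0 hE hw0 hw10 hw20 hw hdw hwt hw1 haxi hv1 hv2 hpz hf
  linarith

/-! ### §2 The threshold `−√(−∂_z²p)`: comparison with a pressure-curvature bound of either sign -/

/-- Monotone on `[a, b]` from pointwise `HasDerivAt` data with non-negative derivative. [folklore] -/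
private theorem monotoneOn_Icc {g g' : ℝ → ℝ} {a b : ℝ} (hg : ∀ t ∈ Icc a b, HasDerivAt g (g' t) t)
    (hg' : ∀ t ∈ Icc a b, 0 ≤ g' t) : MonotoneOn g (Icc a b) :=
  monotoneOn_of_hasDerivWithinAt_nonneg (f' := g') (convex_Icc a b)
    (fun t ht => (hg t ht).continuousAt.continuousWithinAt)
    (fun t ht => (hg t (interior_subset ht)).hasDerivWithinAt)
    (fun t ht => hg' t (interior_subset ht))


/-- **Margin persists.** If `l' ≤ −l² + B` on `[0, T]` (`0 ≤ B`, i.e. `−∂₃²p ≤ B` along the trajectory)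
and `l(0) < −√B`, then `l ≤ l(0)` on `[0, T]` (fencing with the constant `l(0)`: where `l = l(0)`,
`l' ≤ −l(0)² + B < 0`). [standard ODE comparison; new here as typed] -/
theorem le_init_of_deriv_le_neg_sq_add {l l' : ℝ → ℝ} {T B : ℝ} (hB : 0 ≤ B)
    (hl : ∀ t ∈ Icc 0 T, HasDerivAt l (l' t) t) (hle : ∀ t ∈ Icc 0 T, l' t ≤ -(l t) ^ 2 + B)
    (h0 : l 0 < -Real.sqrt B) {t : ℝ} (ht : t ∈ Icc 0 T) : l t ≤ l 0 := by
  have hsq : B < (l 0) ^ 2 := by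
    have hs0 : 0 ≤ Real.sqrt B := Real.sqrt_nonneg B
    nlinarith [Real.sq_sqrt hB, mul_pos (by linarith : 0 < -l 0 - Real.sqrt B)
      (by linarith : 0 < -l 0 + Real.sqrt B)]
  have key := image_le_of_deriv_right_lt_deriv_boundary' (f := l) (f' := l') (a := 0) (b := T)
    (fun s hs => (hl s hs).continuousAt.continuousWithinAt)
    (fun s hs => (hl s (Ico_subset_Icc_self hs)).hasDerivWithinAt)
    (B := fun _ => l 0) (B' := fun _ => 0) le_rfl continuousOn_const
    (fun s _ => (hasDerivAt_const s (l 0)).hasDerivWithinAt)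
    (fun s hs hsl => by
      have h := hle s (Ico_subset_Icc_self hs)
      rw [hsl] at h
      show l' s < 0
      linarith)
  exact key ht

/-- **Quantitative blow-up time under a pressure-Hessian floor** (comparison with `−√B·coth(√B·)`).
If `l' ≤ −l² + B` on `[0, T]` with `B > 0` and `l(0) < −√B`, then
`T < log((l(0) − √B)/(l(0) + √B)) / (2√B)` (`= artanh(√B/|l(0)|)/√B`): with
`w = (l + √B)/(l − √B) ∈ (0, 1)` one has `w' ≥ 2√B·w`, so `w(0)·e^{2√B t} ≤ w(t) < 1`. For `B → 0`
this is `T < −1/l(0)` (CCW Thm 4.1, `Literature…ReflectionPlaneStrain.time_lt_of_deriv_le_neg_sq`). [standard ODE comparison; new here as typed] -/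
theorem time_lt_of_deriv_le_neg_sq_add {l l' : ℝ → ℝ} {T B : ℝ} (hT : 0 ≤ T) (hB : 0 < B)
    (hl : ∀ t ∈ Icc 0 T, HasDerivAt l (l' t) t) (hle : ∀ t ∈ Icc 0 T, l' t ≤ -(l t) ^ 2 + B)
    (h0 : l 0 < -Real.sqrt B) :
    T < Real.log ((l 0 - Real.sqrt B) / (l 0 + Real.sqrt B)) / (2 * Real.sqrt B) := by
  set s : ℝ := Real.sqrt B with hs
  have hs0 : 0 < s := Real.sqrt_pos.2 hB
  have hss : s * s = B := by rw [hs]; exact Real.mul_self_sqrt hB.le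
  have htop : ∀ t ∈ Icc 0 T, l t ≤ l 0 := fun t ht =>
    le_init_of_deriv_le_neg_sq_add hB.le hl hle h0 ht
  have hm : ∀ t ∈ Icc 0 T, l t - s < 0 := fun t ht => by linarith [htop t ht]
  have hp : ∀ t ∈ Icc 0 T, l t + s < 0 := fun t ht => by linarith [htop t ht]
  -- `w = (l + s)/(l − s)` and `ψ = w · exp(−2 s t)`
  set w : ℝ → ℝ := fun t => (l t + s) / (l t - s) with hw
  have hwpos : ∀ t ∈ Icc 0 T, 0 < w t := fun t ht => div_pos_iff.2 (Or.inr ⟨hp t ht, hm t ht⟩)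
  have hwlt : ∀ t ∈ Icc 0 T, w t < 1 := fun t ht => by
    simp only [hw]
    rw [div_lt_one_of_neg (hm t ht)]
    linarith
  have hwder : ∀ t ∈ Icc 0 T, HasDerivAt w (-(2 * s) * l' t / (l t - s) ^ 2) t := by
    intro t ht
    have h1 : HasDerivAt (fun t => l t + s) (l' t) t := (hl t ht).add_const s
    have h2 : HasDerivAt (fun t => l t - s) (l' t) t := (hl t ht).sub_const s
    have h := h1.div h2 (hm t ht).ne
    refine h.congr_deriv ?_
    ring
  -- `w' ≥ 2 s w`
  have hwineq : ∀ t ∈ Icc 0 T, 2 * s * w t ≤ -(2 * s) * l' t / (l t - s) ^ 2 := by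
    intro t ht
    have hne : l t - s ≠ 0 := (hm t ht).ne
    have hd : 0 < (l t - s) ^ 2 := by rw [sq]; exact mul_pos_of_neg_of_neg (hm t ht) (hm t ht)
    rw [le_div_iff₀ hd]
    simp only [hw]
    have hlt := hle t ht
    have e1 : 2 * s * ((l t + s) / (l t - s)) * (l t - s) ^ 2
        = 2 * s * ((l t + s) * (l t - s)) := by
      field_simp
    rw [e1]
    have e2 : (l t + s) * (l t - s) = (l t) ^ 2 - B := by rw [← hss]; ring
    rw [e2]
    nlinarith [hs0, hlt]
  set ψ : ℝ → ℝ := fun t => w t * Real.exp (-(2 * s) * t) with hψ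
  have hψder : ∀ t ∈ Icc 0 T, HasDerivAt ψ
      ((-(2 * s) * l' t / (l t - s) ^ 2) * Real.exp (-(2 * s) * t)
        + w t * (Real.exp (-(2 * s) * t) * (-(2 * s)))) t := by
    intro t ht
    have he : HasDerivAt (fun t => Real.exp (-(2 * s) * t))
        (Real.exp (-(2 * s) * t) * (-(2 * s))) t := by
      simpa using ((hasDerivAt_id t).const_mul (-(2 * s))).exp
    exact (hwder t ht).mul he
  have hψmono : MonotoneOn ψ (Icc 0 T) := by
    refine monotoneOn_Icc hψder fun t ht => ?_
    have hex : 0 < Real.exp (-(2 * s) * t) := Real.exp_pos _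
    have hnn : 0 ≤ (-(2 * s) * l' t / (l t - s) ^ 2 - 2 * s * w t) * Real.exp (-(2 * s) * t) :=
      mul_nonneg (by linarith [hwineq t ht]) hex.le
    have e : -(2 * s) * l' t / (l t - s) ^ 2 * Real.exp (-(2 * s) * t)
        + w t * (Real.exp (-(2 * s) * t) * -(2 * s))
        = (-(2 * s) * l' t / (l t - s) ^ 2 - 2 * s * w t) * Real.exp (-(2 * s) * t) := by ring
    rw [e]
    exact hnn
  have hψ0T := hψmono (left_mem_Icc.2 hT) (right_mem_Icc.2 hT) hT
  simp only [hψ, mul_zero, Real.exp_zero, mul_one] at hψ0T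
  have hexT : 0 < Real.exp (-(2 * s) * T) := Real.exp_pos _
  have h1 : w 0 < Real.exp (-(2 * s) * T) := by
    calc w 0 ≤ w T * Real.exp (-(2 * s) * T) := hψ0T
      _ < 1 * Real.exp (-(2 * s) * T) := mul_lt_mul_of_pos_right (hwlt T (right_mem_Icc.2 hT)) hexT
      _ = Real.exp (-(2 * s) * T) := one_mul _
  have hw0 : 0 < w 0 := hwpos 0 (left_mem_Icc.2 hT)
  -- take logarithms
  have h2 : Real.log (w 0) < -(2 * s) * T := by
    have := Real.log_lt_log hw0 h1
    rwa [Real.log_exp] at this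
  have h3 : (2 * s) * T < Real.log ((l 0 - s) / (l 0 + s)) := by
    have hinv : (l 0 - s) / (l 0 + s) = (w 0)⁻¹ := by
      simp only [hw]
      rw [inv_div]
    rw [hinv, Real.log_inv]
    linarith
  have h2s : 0 < 2 * s := by positivity
  rw [lt_div_iff₀ h2s]
  linarith

/-- **No runaway above the threshold.** If `l' ≥ −l² + B₁` on `[0, T]` with `B₁ > 0` (i.e.
`−∂₃²p ≥ B₁` along the trajectory) and `l(0) > −√B₁`, then `l(t) ≥ min (l(0)) (√B₁)` for all
`t ∈ [0, T]` (fencing `−l` with every constant `−v`, `v ∈ (−√B₁, √B₁)`, `v ≤ l(0)`: where `l = v`,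
`l' ≥ B₁ − v² > 0`). In particular the strain never becomes more compressive than
`min(l(0), √B₁) > −√B₁`. [standard ODE comparison; new here as typed] -/
theorem min_le_of_deriv_ge_neg_sq_add {l l' : ℝ → ℝ} {T B₁ : ℝ} (hB₁ : 0 < B₁)
    (hl : ∀ t ∈ Icc 0 T, HasDerivAt l (l' t) t) (hge : ∀ t ∈ Icc 0 T, -(l t) ^ 2 + B₁ ≤ l' t)
    (h0 : -Real.sqrt B₁ < l 0) {t : ℝ} (ht : t ∈ Icc 0 T) : min (l 0) (Real.sqrt B₁) ≤ l t := by
  set s : ℝ := Real.sqrt B₁ with hs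
  have hs0 : 0 < s := Real.sqrt_pos.2 hB₁
  have hss : s ^ 2 = B₁ := by rw [hs]; exact Real.sq_sqrt hB₁.le
  -- fencing: for every `v` with `−s < v < s` and `v ≤ l 0`, `l ≥ v` on `[0, T]`
  have fence : ∀ v : ℝ, -s < v → v < s → v ≤ l 0 → v ≤ l t := by
    intro v hv1 hv2 hv0
    have hv2B : v ^ 2 < B₁ := by
      nlinarith [mul_pos (by linarith : 0 < s - v) (by linarith : 0 < s + v)]
    have key := image_le_of_deriv_right_lt_deriv_boundary' (f := fun t => -l t)
      (f' := fun t => -l' t) (a := 0) (b := T)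
      (fun r hr => (hl r hr).neg.continuousAt.continuousWithinAt)
      (fun r hr => (hl r (Ico_subset_Icc_self hr)).neg.hasDerivWithinAt)
      (B := fun _ => -v) (B' := fun _ => 0) (by simpa using hv0) continuousOn_const
      (fun r _ => (hasDerivAt_const r (-v)).hasDerivWithinAt)
      (fun r hr hrl => by
        have h := hge r (Ico_subset_Icc_self hr)
        have hlr : l r = v := by linarith
        rw [hlr] at h
        show -l' r < 0
        linarith)
    simpa using key ht
  by_cases hcase : l 0 < s
  · rw [min_eq_left hcase.le]
    exact fence (l 0) h0 hcase le_rfl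
  · have hcase' : s ≤ l 0 := not_lt.mp hcase
    rw [min_eq_right hcase']
    refine le_of_forall_lt_imp_le_of_dense fun a ha => ?_
    have hv : max a 0 < s := max_lt ha hs0
    have hv' : -s < max a 0 := lt_of_lt_of_le (neg_neg_of_pos hs0) (le_max_right a 0)
    exact (le_max_left a 0).trans (fence (max a 0) hv' hv (hv.le.trans hcase'))



/-! ### §3 Readings for the Z8-1 endings -/

/-- **Stationary strain ⇒ the plane is a pressure maximum across itself.** If at some instant along
the trajectory `l' = −l² − P` and `l' = 0` (the normal strain is momentarily stationary along the flow —
e.g. a saturated compressive strain), then `P = −l² ≤ 0`: the normal pressure curvature `∂₃²p` equals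
minus the squared strain. [standard ODE comparison; new here as typed] -/
theorem pressureHessian_eq_neg_sq_of_stationary {lt l P : ℝ} (heq : lt = -l ^ 2 - P)
    (hstat : lt = 0) : P = -l ^ 2 ∧ P ≤ 0 := by
  refine ⟨by linarith, ?_⟩
  nlinarith [sq_nonneg l]


/-- **Ending (i) read on the pressure: saturation ⇒ `∂_z²p|₀ → −s∞²`.** If along a plane path
`l' = −l² − P` for all times, the strain SATURATES (`l → s∞`) and its rate dies out (`l' → 0`), then the
normal pressure curvature converges, `P → −s∞²` (`≤ 0`, `< 0` unless `s∞ = 0`): «exponential growth of the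
front steepness at the saturated strain» is the statement that the plane became a pressure maximum across
itself of curvature exactly `s∞²`. [new here — reading of PREREG-Z8-1L ending (i)] -/
theorem normalCurvature_tendsto_of_saturation {l l' P : ℝ → ℝ} {sinf : ℝ}
    (heq : ∀ t, l' t = -(l t) ^ 2 - P t) (hl : Tendsto l atTop (𝓝 sinf))
    (hl' : Tendsto l' atTop (𝓝 0)) : Tendsto P atTop (𝓝 (-sinf ^ 2)) := by
  have hP : P = fun t => -(l t) ^ 2 - l' t := funext fun t => by linarith [heq t]
  rw [hP]
  have h := ((hl.pow 2).neg).sub hl'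
  simpa using h

/-- **KEEP-shape needs a margin below `σ²` (contrapositive of the threshold).** If along a plane path on
`[0, T]` the strain history obeys `l' ≤ −l² + B` (`B > 0`: the normal pressure curvature never helps more
than `−∂_z²p ≤ B`) and starts past the threshold, `l(0) < −√B`, then the path cannot be followed beyond
`log((l₀ − √B)/(l₀ + √B))/(2√B)`: a smooth MODEL run that IS followed longer on such a path had
`−∂_z²p|₀ > B` somewhere on it (the pressure fought back) or never crossed `−√B`. Restatement of
`time_lt_of_deriv_le_neg_sq_add` as the negation used by the zone reading. [new here — reading] -/
theorem not_margin_of_followed {l l' : ℝ → ℝ} {T B : ℝ} (hB : 0 < B)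
    (hl : ∀ t ∈ Icc 0 T, HasDerivAt l (l' t) t) (h0 : l 0 < -Real.sqrt B)
    (hT : Real.log ((l 0 - Real.sqrt B) / (l 0 + Real.sqrt B)) / (2 * Real.sqrt B) ≤ T) :
    ¬ (∀ t ∈ Icc 0 T, l' t ≤ -(l t) ^ 2 + B) := by
  intro hle
  have hT0 : 0 ≤ T := by
    have hs0 : 0 < Real.sqrt B := Real.sqrt_pos.2 hB
    have hlog : 0 ≤ Real.log ((l 0 - Real.sqrt B) / (l 0 + Real.sqrt B)) := by
      apply Real.log_nonneg
      rw [le_div_iff_of_neg (by linarith)]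
      linarith
    exact le_trans (div_nonneg hlog (by positivity)) hT
  exact absurd hT (not_le.mpr (time_lt_of_deriv_le_neg_sq_add hT0 hB hl hle h0))

end MirrorPlaneStrainRiccati
end Summit.NavierStokesRegularity.OSWSelfSimilar
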